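import Mathlib

/-!
# Sketch — crux-ideate stmt-HodgeConjecture-13680 (SquareHodgeOfSqrtTwo), ideator 2, round 1

First lemmas of the two idea cards (they only need to elaborate; easy ones are proved).

* Card A `octic-anchor-semiregular-spread`: `twinLocus_forward` — the linear algebra behind
  "the Hodge locus of φ = g^* + g^{*-1} is the φ-twin locus {σ ∈ ker(φ² − 2)}, whose diagonal is
  the RM-√2 family": for a `Q`-self-adjoint rational `φ` and an isotropic `σ` with `φ²σ = 2σ`,
  `φσ` is isotropic and `φ` carries `σ^⊥` into `(φσ)^⊥` (the (2,0) and (1,1) Hodge conditions).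
* (not filed as a card; NOTES.md barrier note B3 `dihedral-hecke-sweep`): the Dickson/Chebyshev identities `D₈(u + u⁻¹) = u⁸ + u⁻⁸`,
  `D₈(s) − 2 = (s² − 4)s²(s² − 2)²`, `D₈(s) + 2 = (s⁴ − 4s² + 2)²` (branch structure of the
  reflection quotient X_φ : D₈(s) = φ over φ = ±2), and the Hecke eigenvalue `(ζ + ζ⁻¹)² = 2`
  for `ζ⁴ = −1`.
-/

namespace Summit.HodgeConjecture.HodgeConjecture.Cruxes.SquareHodgeOfSqrtTwo.IdeatorTwo

open Matrix

/-- complexification of a rational matrix -/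
abbrev cplx {n : ℕ} (M : Matrix (Fin n) (Fin n) ℚ) : Matrix (Fin n) (Fin n) ℂ :=
  M.map (fun q : ℚ => (q : ℂ))

/-- the complex-bilinear extension of the rational form with Gram matrix `Q` -/
abbrev formC {n : ℕ} (Q : Matrix (Fin n) (Fin n) ℚ) (x y : Fin n → ℂ) : ℂ :=
  x ⬝ᵥ (cplx Q).mulVec y

/-- **Card A, first lemma (forward half of the twin-locus computation).**
`Q` a rational symmetric Gram matrix (the K3 form on `H²(S₀,ℚ)`), `φ` rational and `Q`-self-adjoint
(`φ = g^* + (g^*)⁻¹` for an isometry `g^*`), `σ` a complex isotropic vector (a period) lying in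
`ker(φ² − 2)`. Then the candidate twin period `φσ` is isotropic, positivity is preserved up to the
factor `2`, and `φ` maps `σ^⊥` into `(φσ)^⊥` — i.e. the class of `φ` in `H²(S_u)^∨ ⊗ H²(S_t)` is of
type `(2,2)` on `S_t × S_u` whenever `σ_u ∈ ker(φ² − 2)` and `σ_t ∝ φσ_u`. (The converse — off
`ker(φ²−2)` the class is not Hodge near periods with non-zero `ker(φ²−2)`-component — is the other
half, by the same self-adjointness computation; NOTES.md.) -/
theorem twinLocus_forward (n : ℕ) (Q φ : Matrix (Fin n) (Fin n) ℚ)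
    (hQ : Q.IsSymm) (hadj : φ.transpose * Q = Q * φ)
    (σ : Fin n → ℂ)
    (hker : (cplx (φ * φ)).mulVec σ = (2 : ℂ) • σ)
    (hiso : formC Q σ σ = 0) :
    formC Q ((cplx φ).mulVec σ) ((cplx φ).mulVec σ) = 0 ∧
    formC Q ((cplx φ).mulVec σ) (star ((cplx φ).mulVec σ)) = 2 * formC Q σ (star σ) ∧
    ∀ x : Fin n → ℂ, formC Q x σ = 0 →
      formC Q ((cplx φ).mulVec x) ((cplx φ).mulVec σ) = 0 := by
  sorry

/-- Dimension bookkeeping of Card A (trivial arithmetic, recorded for the card): for the maximal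
RM-√2 families `rank T = 2k = 20`, the RM family has dimension `k − 2 = 8`, the φ-twin locus has
dimension `2k − 2 = 18`, its codimension in `Def(S₀)² = 40` is `22`, and Bloch's window for an
l.c.i. carrier `Z ⊂ S₀ × S₀` is `22 ≤ h¹(N_Z) ≤ h^{1,3}(S₀ × S₀) = 40`. -/
theorem cardA_window : (20 / 2 - 2 = 8) ∧ (2 * 10 - 2 = 18) ∧ (40 - 18 = 22) ∧
    (2 * (1 * 20) = 40) := by decide

/-- **Card A, anchor lattice (i): the octic plane.** `U ⊕ U(2)` carries an isometry of order 8 with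
characteristic polynomial `x⁴ + 1`: in the basis `1, ζ, ζ², ζ³` of `ℤ[ζ₈]` with the even form
`b(x,y) = Tr(√2·x·ȳ/4)` the Gram matrix is `G` below (even, det 4, signature (2,2), 2-elementary with
δ = 0, hence `≅ U ⊕ U(2)`), and multiplication by `ζ₈` is the companion matrix `M` of `x⁴ + 1`.
Kernel-decidable. Together with an order-8 isometry of `E₈` of type `(x⁴+1)²` (next lemma) this gives
the order-8 isometry of `U ⊕ U(2) ⊕ E₈²` of type `Φ₈⁵` behind the 4-dimensional octic anchor family
`w² = F(x,y)`, `F(y,−x) = i·F(x,y)` on the maximal `U(2)`-polarised RM-√2 component. -/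
theorem octicPlane :
    let G : Matrix (Fin 4) (Fin 4) ℤ := !![0, 1, 0, -1; 1, 0, 1, 0; 0, 1, 0, 1; -1, 0, 1, 0]
    let M : Matrix (Fin 4) (Fin 4) ℤ := !![0, 0, 0, -1; 1, 0, 0, 0; 0, 1, 0, 0; 0, 0, 1, 0]
    M.transpose * G * M = G ∧ M ^ 4 = -1 ∧ G.det = 4 ∧ (∀ i, G i i = 0) := by
  refine ⟨by decide, by decide, by decide +kernel, by decide⟩

/-- **Card A, anchor lattice (ii)** (kernel-decided): `E₈` admits an isometry `M` with `M⁴ = −1`, i.e. of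
characteristic polynomial `(x⁴ + 1)²`, making `E₈` a `ℤ[ζ₈]`-module of rank 2 (two signed 4-cycles of
`W(D₈) ⊂ W(E₈)`). With `octicPlane`: `U ⊕ U(2) ⊕ E₈²` has an order-8 isometry of type `Φ₈⁵`. -/
theorem e8_octic : ∃ M : Matrix (Fin 8) (Fin 8) ℤ,
    M.transpose * CartanMatrix.E₈ * M = CartanMatrix.E₈ ∧ M ^ 4 = -1 := by
  -- two signed 4-cycles e₁→e₂→e₃→e₄→−e₁, e₅→e₆→e₇→e₈→−e₅ of W(D₈) ⊂ W(E₈), written in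
  -- Bourbaki's simple-root basis (column i = coordinates of g(αᵢ)); found by a 20-line script.
  refine ⟨!![-1, 0, 0, 0, 0, 0, 0, 2; -2, 1, 0, 0, -1, 1, 0, 2; -3, 1, 0, 0, 0, 0, 0, 3;
      -5, 1, 1, 0, -1, 1, 0, 4; -4, 0, 0, 1, -1, 1, 0, 3; -3, 0, 0, 0, 0, 1, 0, 2;
      -2, 0, 0, 0, 0, 1, 0, 1; -1, 0, 0, 0, 0, 0, 1, 0], ?_, ?_⟩
  · decide +kernel
  · decide +kernel

/-- **Barrier note B3 (i): the Dickson/Chebyshev identity** behind reflection quotients of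
`D₈`-covers: with `s = u + u⁻¹`, `D₈(s) = u⁸ + u⁻⁸`, where
`D₈(s) = s⁸ − 8s⁶ + 20s⁴ − 16s² + 2 = 2·T₈(s/2)`. -/
theorem dickson8_eval {K : Type*} [Field K] (u : K) (hu : u ≠ 0) :
    (u + u⁻¹) ^ 8 - 8 * (u + u⁻¹) ^ 6 + 20 * (u + u⁻¹) ^ 4 - 16 * (u + u⁻¹) ^ 2 + 2
      = u ^ 8 + (u⁻¹) ^ 8 := by
  field_simp
  ring

/-- **Barrier note B3 (ii): branch structure over `φ = 2`** — `D₈(s) − 2 = (s² − 4)·s²·(s² − 2)²`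
(two simple sheets `s = ±2`, three ramified pairs `s = 0, ±√2`: a reflection of the first class in
`D₈` fixes 2 of the 8 cosets and swaps 3 pairs). -/
theorem dickson8_sub_two {R : Type*} [CommRing R] (s : R) :
    s ^ 8 - 8 * s ^ 6 + 20 * s ^ 4 - 16 * s ^ 2 + 2 - 2 = (s ^ 2 - 4) * s ^ 2 * (s ^ 2 - 2) ^ 2 := by
  ring

/-- **Barrier note B3 (iii): branch structure over `φ = −2`** — `D₈(s) + 2 = (s⁴ − 4s² + 2)²`
(four ramified pairs: a reflection of the second class swaps 4 pairs of cosets; `s⁴ − 4s² + 2` is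
the minimal polynomial of `2cos(π/8)`). -/
theorem dickson8_add_two {R : Type*} [CommRing R] (s : R) :
    s ^ 8 - 8 * s ^ 6 + 20 * s ^ 4 - 16 * s ^ 2 + 2 + 2 = (s ^ 4 - 4 * s ^ 2 + 2) ^ 2 := by
  ring

/-- **Barrier note B3 (iv): the Hecke eigenvalue.** If `ζ⁴ = −1` (a primitive 8th root of
unity) then `(ζ + ζ⁻¹)² = 2`: the double coset `⟨τ⟩σ⟨τ⟩` acts on the `τ`-invariants of the
4-dimensional rational representation of `D₈` with square `2`, i.e. as real multiplication by `√2`. -/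
theorem hecke_eigenvalue_sq {K : Type*} [Field K] (ζ : K) (h : ζ ^ 4 = -1) :
    (ζ + ζ⁻¹) ^ 2 = 2 := by
  have hz : ζ ≠ 0 := by
    rintro rfl
    norm_num at h
  have h8 : ζ ^ 8 = 1 := by
    have : ζ ^ 8 = (ζ ^ 4) ^ 2 := by ring
    rw [this, h]; norm_num
  have hinv : ζ⁻¹ = ζ ^ 7 := by
    have : ζ * ζ ^ 7 = 1 := by
      calc ζ * ζ ^ 7 = ζ ^ 8 := by ring
        _ = 1 := h8
    exact inv_eq_of_mul_eq_one_right this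
  rw [hinv]
  have : (ζ + ζ ^ 7) ^ 2 = ζ ^ 2 + 2 * (ζ ^ 4) ^ 2 + ζ ^ 2 * (ζ ^ 4) ^ 3 := by ring
  rw [this, h]
  ring

end Summit.HodgeConjecture.HodgeConjecture.Cruxes.SquareHodgeOfSqrtTwo.IdeatorTwo
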